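import Literature.Analysis.FluidPDE.SelfSimilarEulerEnergyLowerBound
import Literature.Analysis.FluidPDE.SteadyNSCaccioppoliTools
import HarnessLib

/-!
# Bronzi–Shvydkoy 2015, §3: the energy bootstrap under a general `L^r` shell growth
# (Theorem 1.1 at the profile level from the pressure law (2.4); Claim 3.1)

Analysis/FluidPDE proof file (theorems only; no definitions, no named facts, no `sorry`) in the
story of `SelfSimilarEulerEnergyConcentration.lean` (the NAMED FACT
`bronziShvydkoy2015_energy_dichotomy` = A. Bronzi, R. Shvydkoy, *On the energy behavior of locally
self-similar blowup for the Euler equation*, Indiana Univ. Math. J. **64** (2015) 1291–1302 =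
arXiv:1310.8611 [BronziShvydkoy2015], **Theorem 1.1**).  Second of three files discharging the fact:
`SelfSimilarEulerPressureShellBound.lean` (Lemma 2.1: the pressure law (2.4)) ⟶ THIS FILE (§3) ⟶
`…Holds.lean` (assembly in the binder shape of the fact).

The tree's `SelfSimilarEulerEnergyLowerBound.lean` runs BS15 §3 in the `L^p` CLASS (`U ∈ L^p(ℝ³)`,
`P ∈ L^{p/2}`, pressure via Chae–Shvydkoy's Lemma 3.3).  Here is the printed generality of
Theorem 1.1: the profile is only `C²` with

* (1.6) the energy growth `∫_{|y|<L}|U|² ≤ C_E L^{3−2α}` (`L ≥ L_E`);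
* (1.7) the SHELL growth `∫_{L<|y|<2L}|U|^r ≤ C₂ L^γ` for large `L`, `r ≥ 3`, `γ < r − 2` — `U`
  need not be in any `L^r(ℝ³)`;
* (2.4) the dyadic pressure law at exponent `3/2` (output of `SelfSimilarEulerPressureShellBound`):
  `(∫_{S_L}|P|^{3/2})^{2/3} ≤ K((∫_{L/2≤|z|<4L}|U|³)^{2/3} + L²(L⁻³∫_{|z|<L/2}|U|² + ∫_{|z|≥4L}|U|²/|z|³))`.

## The argument (BS15 §3, held text pp. 7–8, followed verbatim)

"Assuming, on the contrary, that there is a sequence of `L_n`'s so that `L_n^{2α}⟨|v|²⟩_{L_n} → 0`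
… we obtain (3.1) `⟨|v|²⟩_L ≲ L⁻¹ Σ_k 2^{−k(1−2α)} (⟨|v|³⟩_{2^kL,2^{k+1}L} + ⟨|v|³⟩^{1/3} Σ_l
⟨|v|²⟩_{2^{k+l}L})`" — the tree's pressure-agnostic `twoScaleEnergy_le_dyadicFlux_of_frequently_small`
with the pressure term estimated by Hölder and (2.4).  "Now we initiate a bootstrap procedure on decay
rates of the `L³` and `L²`-averages … `⟨|v|³⟩ ≤ ⟨|v|²⟩^θ⟨|v|^p⟩^{1−θ}`, `θ = (p−3)/(p−2)` …
`a_{n+1} = b_n + 1` provided `(3/2)a_n ≥ b_n`, or otherwise `a_{n+1} = (1/3)b_n + a_n + 1`; then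
`b_{n+1} = θa_{n+1} + (1−θ)c`" (Claim 3.1) "… we eventually reach the bound
`∫_{|y|<L}|v|² ≲ L^{−ε}` for some `ε > 0`, which implies `v ≡ 0`."

In un-averaged form (rates of `∫_{S_L}` rather than `⟨·⟩_L`): with the current energy rate
`∫_{|y|<L}|U|² ≲ L^{3−a}` (`2α ≤ a ≤ 3`): `∫_{S_L}|U|³ ≲ L^{3−b}`, `b = θa + (1−θ)(3−γ)`
(`shell_L3_rate`); the far weight `∫_{|z|≥R}|U|²/|z|³ ≲ R^{−a}` (`farWeight_integrableOn_and_le`,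
BS15 §2 Step 1); `(∫_{S_L}|P|^{3/2})^{2/3} ≲ L^{2−2b/3} + L^{2−a}` (`shell_pressure_rate`); flux
`∫_{S_L}(|U|³+2|P||U|) ≲ L^{e}`, `e = max(3 − min(b, b/3+a), 1/3)` (`shell_flux_rate`); dyadic sums
`≲ l^{2α−4+e}` (`dyadicFluxSum_le`, `2α−4+e < 0`); new energy rate `4 − e ≥ a + δ`,
`δ = min((r−2−γ)/(r−2), 2/3) > 0` (`energyRate_step`, `claim31_step`); after
`⌊(3−2α)/δ⌋+1` steps the rate exceeds `3` and `U = 0` (tree `eq_zero_of_energyGrowth_of_three_halves_lt`).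

Main results: `IsSelfSimilarEulerProfile.eq_zero_of_shellGrowth_of_pressureLaw` (the exclusion
under frequently-small rescaled energy) and
`IsSelfSimilarEulerProfile.energy_dichotomy_of_shellGrowth_of_pressureLaw` (**Theorem 1.1 (1.8) at
the profile level**: `U = 0` or `c L^{3−2α} ≤ ∫_{|y|<L}|U|² ≤ C L^{3−2α}`).

## Mathlib / tree search

Reused: `IsSelfSimilarEulerProfile.twoScaleEnergy_le_dyadicFlux_of_frequently_small`
(`SelfSimilarEulerEnergyLowerBound`), `eq_zero_of_energyGrowth_of_three_halves_lt`
(`SelfSimilarEulerLpExclusion`), `setIntegral_mul_norm_le_rpow`, `memLp_restrict_of_continuous_isBounded`,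
`setIntegral_norm_rpow_three_nonneg` (`SteadyNSCaccioppoliTools`).  Mathlib:
`integral_mul_le_Lp_mul_Lq_of_nonneg` (Hölder), `Measure.addHaar_sphere`, `setIntegral_congr_set`,
`lintegral_iUnion`, `ENNReal.ofReal_tsum_of_nonneg`, `hasSum_geometric_of_lt_one`,
`exists_nat_pow_near`, `Nat.floor_le`, `Nat.lt_floor_add_one`.  `lean search 'shellGrowth|Claim 3.1|
bootstrap.*shell'`: only the `L^p`-class file above.  No new definitions, no instances, no notation.
-/

noncomputable section

open MeasureTheory Set Filter Topology Metric
open scoped ENNReal NNReal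

namespace Literature.Analysis.FluidPDE

namespace BronziShvydkoy2015

/-! ## §0 Shell bookkeeping -/

/-- The open dyadic shell `{M < |y| < 2M}` is measurable. [folklore] -/
private theorem measurableSet_shell (M : ℝ) :
    MeasurableSet {y : EuclideanSpace ℝ (Fin 3) | M < ‖y‖ ∧ ‖y‖ < 2 * M} :=
  (isOpen_lt continuous_const continuous_norm).measurableSet.inter
    (isOpen_lt continuous_norm continuous_const).measurableSet

/-- The open dyadic shell is bounded. [folklore] -/
private theorem isBounded_shell (M : ℝ) :
    Bornology.IsBounded {y : EuclideanSpace ℝ (Fin 3) | M < ‖y‖ ∧ ‖y‖ < 2 * M} :=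
  (isBounded_ball (x := (0 : EuclideanSpace ℝ (Fin 3))) (r := 2 * M)).subset fun y hy => by
    rw [mem_ball_zero_iff]; exact hy.2

/-- The annulus `{M/2 ≤ |y| < 4M}` is bounded. [folklore] -/
private theorem isBounded_annulus (M : ℝ) :
    Bornology.IsBounded {y : EuclideanSpace ℝ (Fin 3) | M / 2 ≤ ‖y‖ ∧ ‖y‖ < 4 * M} :=
  (isBounded_ball (x := (0 : EuclideanSpace ℝ (Fin 3))) (r := 4 * M)).subset fun y hy => by
    rw [mem_ball_zero_iff]; exact hy.2

/-- A continuous function is integrable on a bounded set. [folklore] -/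
private theorem integrableOn_of_continuous_isBounded {f : EuclideanSpace ℝ (Fin 3) → ℝ}
    (hf : Continuous f) {S : Set (EuclideanSpace ℝ (Fin 3))} (hS : Bornology.IsBounded S) :
    IntegrableOn f S volume :=
  memLp_one_iff_integrable.1 (memLp_restrict_of_continuous_isBounded hf hS 1)

/-- **The annulus `{M/2 ≤ |y| < 4M}` is, up to three null spheres, the union of the dyadic shells
`S_{M/2} ∪ S_M ∪ S_{2M}`**: for a continuous `f`,
`∫_{M/2≤|y|<4M} f = ∫_{S_{M/2}} f + ∫_{S_M} f + ∫_{S_{2M}} f`. [folklore] -/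
private theorem setIntegral_annulus_eq_three_shells {f : EuclideanSpace ℝ (Fin 3) → ℝ}
    (hf : Continuous f) {M : ℝ} (hM : 0 < M) :
    ∫ y in {y : EuclideanSpace ℝ (Fin 3) | M / 2 ≤ ‖y‖ ∧ ‖y‖ < 4 * M}, f y =
      (∫ y in {y : EuclideanSpace ℝ (Fin 3) | M / 2 < ‖y‖ ∧ ‖y‖ < 2 * (M / 2)}, f y) +
        (∫ y in {y : EuclideanSpace ℝ (Fin 3) | M < ‖y‖ ∧ ‖y‖ < 2 * M}, f y) +
        ∫ y in {y : EuclideanSpace ℝ (Fin 3) | 2 * M < ‖y‖ ∧ ‖y‖ < 2 * (2 * M)}, f y := by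
  set A : Set (EuclideanSpace ℝ (Fin 3)) := {y | M / 2 ≤ ‖y‖ ∧ ‖y‖ < 4 * M} with hA
  set S₁ : Set (EuclideanSpace ℝ (Fin 3)) := {y | M / 2 < ‖y‖ ∧ ‖y‖ < 2 * (M / 2)} with hS₁
  set S₂ : Set (EuclideanSpace ℝ (Fin 3)) := {y | M < ‖y‖ ∧ ‖y‖ < 2 * M} with hS₂
  set S₃ : Set (EuclideanSpace ℝ (Fin 3)) := {y | 2 * M < ‖y‖ ∧ ‖y‖ < 2 * (2 * M)} with hS₃
  have hAi : IntegrableOn f A volume := integrableOn_of_continuous_isBounded hf (isBounded_annulus M)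
  have hS₂m : MeasurableSet S₂ := measurableSet_shell M
  have hS₃m : MeasurableSet S₃ := measurableSet_shell (2 * M)
  have hsub : S₁ ∪ S₂ ∪ S₃ ⊆ A := by
    rintro y ((hy | hy) | hy)
    · exact ⟨hy.1.le, by linarith [hy.2]⟩
    · exact ⟨by linarith [hy.1], by linarith [hy.2]⟩
    · exact ⟨by linarith [hy.1], by linarith [hy.2]⟩
  have hdiff : A \ (S₁ ∪ S₂ ∪ S₃) ⊆ sphere (0 : EuclideanSpace ℝ (Fin 3)) (M / 2) ∪
      (sphere (0 : EuclideanSpace ℝ (Fin 3)) M ∪ sphere (0 : EuclideanSpace ℝ (Fin 3)) (2 * M)) := by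
    rintro y ⟨⟨hlo, hhi⟩, hyn⟩
    simp only [mem_union, mem_sphere_zero_iff_norm]
    by_contra hne
    push Not at hne
    obtain ⟨hne1, hne2, hne3⟩ := hne
    apply hyn
    rcases lt_or_gt_of_ne hne2 with h2 | h2
    · exact Or.inl (Or.inl ⟨lt_of_le_of_ne hlo (Ne.symm hne1), by linarith⟩)
    · rcases lt_or_gt_of_ne hne3 with h3 | h3
      · exact Or.inl (Or.inr ⟨h2, h3⟩)
      · exact Or.inr ⟨h3, by linarith⟩
  have hae : A =ᵐ[volume] (S₁ ∪ S₂ ∪ S₃ : Set (EuclideanSpace ℝ (Fin 3))) := by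
    refine ae_eq_set.2 ⟨?_, ?_⟩
    · exact measure_mono_null hdiff (measure_union_null (Measure.addHaar_sphere volume _ _)
        (measure_union_null (Measure.addHaar_sphere volume _ _) (Measure.addHaar_sphere volume _ _)))
    · exact measure_mono_null (fun y hy => absurd (hsub hy.1) hy.2) measure_empty
  have hd12 : Disjoint S₁ S₂ := by
    rw [disjoint_left]; rintro y ⟨-, h1⟩ ⟨h2, -⟩; linarith
  have hd3 : Disjoint (S₁ ∪ S₂) S₃ := by
    rw [disjoint_left]
    rintro y (⟨-, h1⟩ | ⟨-, h1⟩) ⟨h2, -⟩ <;> linarith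
  rw [setIntegral_congr_set hae,
    setIntegral_union hd3 hS₃m (hAi.mono_set (subset_union_left.trans hsub))
      (hAi.mono_set (subset_union_right.trans hsub)),
    setIntegral_union hd12 hS₂m
      (hAi.mono_set ((subset_union_left.trans subset_union_left).trans hsub))
      (hAi.mono_set ((subset_union_right.trans subset_union_left).trans hsub))]

/-- A shell integral of a non-negative continuous function is at most the integral over the ball
of twice the radius. [folklore] -/
private theorem setIntegral_shell_le_ball {f : EuclideanSpace ℝ (Fin 3) → ℝ} (hf : Continuous f)
    (hf0 : ∀ y, 0 ≤ f y) (M : ℝ) :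
    ∫ y in {y : EuclideanSpace ℝ (Fin 3) | M < ‖y‖ ∧ ‖y‖ < 2 * M}, f y ≤
      ∫ y in ball (0 : EuclideanSpace ℝ (Fin 3)) (2 * M), f y :=
  setIntegral_mono_set (integrableOn_of_continuous_isBounded hf isBounded_ball)
    (Eventually.of_forall hf0) (Eventually.of_forall fun _ hy => mem_ball_zero_iff.2 hy.2)

/-- `(2^j)^d = (2^d)^j`. [folklore] -/
private theorem two_pow_rpow_comm (d : ℝ) (j : ℕ) :
    ((2 : ℝ) ^ j) ^ d = ((2 : ℝ) ^ d) ^ j := by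
  rw [← Real.rpow_natCast 2 j, ← Real.rpow_mul (by norm_num : (0 : ℝ) ≤ 2), mul_comm,
    Real.rpow_mul (by norm_num : (0 : ℝ) ≤ 2), Real.rpow_natCast]

/-- Partial sums of a geometric series with ratio `0 ≤ q < 1` are at most `(1 − q)⁻¹`. [folklore] -/
private theorem geom_partial_sum_le {q : ℝ} (hq0 : 0 ≤ q) (hq1 : q < 1) (k : ℕ) :
    ∑ j ∈ Finset.range k, q ^ j ≤ (1 - q)⁻¹ := by
  have h1 : 0 < 1 - q := by linarith
  have hmul : (∑ j ∈ Finset.range k, q ^ j) * (1 - q) ≤ 1 := by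
    rw [geom_sum_mul_neg]
    linarith [pow_nonneg hq0 k]
  calc ∑ j ∈ Finset.range k, q ^ j
      = (∑ j ∈ Finset.range k, q ^ j) * (1 - q) / (1 - q) := by field_simp
    _ ≤ 1 / (1 - q) := div_le_div_of_nonneg_right hmul h1.le
    _ = (1 - q)⁻¹ := one_div _

/-- **Interpolation of the `L³` shell norm between `L²` and `L^r`** (BS15 §3: "we will repeatedly
use interpolation inequality with `θ = (p−3)/(p−2)`: `⟨|v|³⟩ ≤ ⟨|v|²⟩^θ ⟨|v|^p⟩^{1−θ}`"), for a
continuous field on a bounded set, `r ≥ 3`. [cite: BronziShvydkoy2015, §3 (proof of Thm. 1.1, interpolation display)] -/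
theorem setIntegral_norm_rpow_three_le_interpolation
    {U : EuclideanSpace ℝ (Fin 3) → EuclideanSpace ℝ (Fin 3)} (hU : Continuous U)
    {S : Set (EuclideanSpace ℝ (Fin 3))} (hS : Bornology.IsBounded S) {r : ℝ} (hr : 3 ≤ r) :
    ∫ y in S, ‖U y‖ ^ (3 : ℝ) ≤
      (∫ y in S, ‖U y‖ ^ 2) ^ ((r - 3) / (r - 2)) * (∫ y in S, ‖U y‖ ^ r) ^ (1 - (r - 3) / (r - 2)) := by
  rcases hr.eq_or_lt with h3 | h3
  · -- `r = 3`, `θ = 0`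
    rw [← h3]
    norm_num
  set θ : ℝ := (r - 3) / (r - 2) with hθ
  have hr2 : 0 < r - 2 := by linarith
  have hθ0 : 0 < θ := div_pos (by linarith) hr2
  have hθ1 : θ < 1 := (div_lt_one hr2).2 (by linarith)
  have h1θ : 0 < 1 - θ := by linarith
  have hpq : Real.HolderConjugate (1 / θ) (1 / (1 - θ)) :=
    ⟨by rw [one_div, one_div, inv_inv, inv_inv, inv_one]; ring, by positivity, by positivity⟩
  haveI : IsFiniteMeasure (volume.restrict S) := isFiniteMeasure_restrict.2 hS.measure_lt_top.ne
  have hf : MemLp (fun y => ‖U y‖ ^ (2 * θ)) (ENNReal.ofReal (1 / θ)) (volume.restrict S) :=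
    memLp_restrict_of_continuous_isBounded (hU.norm.rpow_const fun _ => Or.inr (by positivity)) hS _
  have hg : MemLp (fun y => ‖U y‖ ^ (r * (1 - θ))) (ENNReal.ofReal (1 / (1 - θ))) (volume.restrict S) :=
    memLp_restrict_of_continuous_isBounded (hU.norm.rpow_const fun _ => Or.inr (by positivity)) hS _
  have h := integral_mul_le_Lp_mul_Lq_of_nonneg (μ := volume.restrict S) hpq
    (Eventually.of_forall fun y => Real.rpow_nonneg (norm_nonneg _) _)
    (Eventually.of_forall fun y => Real.rpow_nonneg (norm_nonneg _) _) hf hg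
  have hexp : 2 * θ + r * (1 - θ) = 3 := by
    rw [hθ]; field_simp; ring
  have e1 : ∀ y : EuclideanSpace ℝ (Fin 3), ‖U y‖ ^ (2 * θ) * ‖U y‖ ^ (r * (1 - θ)) = ‖U y‖ ^ (3 : ℝ) := by
    intro y
    rw [← Real.rpow_add_of_nonneg (norm_nonneg _) (by positivity) (by positivity), hexp]
  have e2 : ∀ y : EuclideanSpace ℝ (Fin 3), (‖U y‖ ^ (2 * θ)) ^ (1 / θ) = ‖U y‖ ^ 2 := by
    intro y
    rw [← Real.rpow_mul (norm_nonneg _), show 2 * θ * (1 / θ) = ((2 : ℕ) : ℝ) by push_cast; field_simp,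
      Real.rpow_natCast]
  have e3 : ∀ y : EuclideanSpace ℝ (Fin 3), (‖U y‖ ^ (r * (1 - θ))) ^ (1 / (1 - θ)) = ‖U y‖ ^ r := by
    intro y
    rw [← Real.rpow_mul (norm_nonneg _)]
    congr 1
    field_simp
  simp only [e1, e2, e3, one_div_one_div] at h
  exact h

/-! ## §1 The far weight from the energy rate (BS15 §2, Step 1: the dyadic far-field sums)

BS15 Step 1: "`|∂^s I₂(y)| ≲ Σ_k ∫_{|z|∼2^kL} |z|^{−N−s}|v|² ≲ Σ_k (2^kL)^{−s}⟨|v|²⟩_{2^kL} ≲ L^{−2α−s}`" —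
the far weight `|v|²/|z|³` is summable over the dyadic shells as soon as the ball energies grow
like `L^{3−a}` with `a > 0`, with `∫_{|z|≥R} |v|²/|z|³ ≲ R^{−a}`. -/

/-- **Dyadic far-field summation**: if `U` is continuous and `∫_{|y|<L} |U|² ≤ C_E L^{3−a}` for
`L ≥ L_E` (`a > 0`, `L_E > 0`), then for `R ≥ L_E` the far weight `|U|²/|z|³` is integrable on
`{|z| ≥ R}` and `∫_{|z|≥R} |U|²/|z|³ ≤ C_E 2^{3−a} (1 − 2^{−a})⁻¹ R^{−a}`. [cite: BronziShvydkoy2015, §2 Lemma 2.1, Step 1] -/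
theorem farWeight_integrableOn_and_le {U : EuclideanSpace ℝ (Fin 3) → EuclideanSpace ℝ (Fin 3)}
    (hU : Continuous U) {a C_E L_E : ℝ} (ha : 0 < a) (hC : 0 ≤ C_E) (hLE : 0 < L_E)
    (hE : ∀ L : ℝ, L_E ≤ L →
      ∫ y in ball (0 : EuclideanSpace ℝ (Fin 3)) L, ‖U y‖ ^ 2 ≤ C_E * L ^ (3 - a))
    {R : ℝ} (hR : L_E ≤ R) :
    IntegrableOn (fun z => ‖U z‖ ^ 2 / ‖z‖ ^ 3) {z : EuclideanSpace ℝ (Fin 3) | R ≤ ‖z‖} volume ∧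
      ∫ z in {z : EuclideanSpace ℝ (Fin 3) | R ≤ ‖z‖}, ‖U z‖ ^ 2 / ‖z‖ ^ 3 ≤
        C_E * (2 : ℝ) ^ (3 - a) * (1 - (2 : ℝ) ^ (-a))⁻¹ * R ^ (-a) := by
  have hR0 : 0 < R := hLE.trans_le hR
  set w : EuclideanSpace ℝ (Fin 3) → ℝ := fun z => ‖U z‖ ^ 2 / ‖z‖ ^ 3 with hw
  have hw0 : ∀ z, 0 ≤ w z := fun z => div_nonneg (sq_nonneg _) (pow_nonneg (norm_nonneg _) _)
  have hwm : Measurable w := (hU.norm.pow 2).measurable.div (continuous_norm.pow 3).measurable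
  -- the dyadic shells
  set T : ℕ → Set (EuclideanSpace ℝ (Fin 3)) :=
    fun j => {z | 2 ^ j * R ≤ ‖z‖ ∧ ‖z‖ < 2 ^ (j + 1) * R} with hT
  have hTm : ∀ j, MeasurableSet (T j) := fun j =>
    (isClosed_le continuous_const continuous_norm).measurableSet.inter
      (isOpen_lt continuous_norm continuous_const).measurableSet
  have hTdisj : Pairwise (Function.onFun Disjoint T) := by
    intro i j hij
    rw [Function.onFun, disjoint_left]
    rintro z ⟨hi1, hi2⟩ ⟨hj1, hj2⟩
    rcases lt_or_gt_of_ne hij with h | h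
    · have : (2 : ℝ) ^ (i + 1) * R ≤ 2 ^ j * R :=
        mul_le_mul_of_nonneg_right (pow_le_pow_right₀ one_le_two h) hR0.le
      linarith
    · have : (2 : ℝ) ^ (j + 1) * R ≤ 2 ^ i * R :=
        mul_le_mul_of_nonneg_right (pow_le_pow_right₀ one_le_two h) hR0.le
      linarith
  have hTunion : (⋃ j, T j) = {z : EuclideanSpace ℝ (Fin 3) | R ≤ ‖z‖} := by
    ext z
    simp only [mem_iUnion, mem_setOf_eq]
    constructor
    · rintro ⟨j, hj1, -⟩
      exact le_trans (le_mul_of_one_le_left hR0.le (one_le_pow₀ one_le_two)) hj1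
    · intro hz
      have hx : 1 ≤ ‖z‖ / R := by rwa [le_div_iff₀ hR0, one_mul]
      obtain ⟨n, hn1, hn2⟩ := exists_nat_pow_near hx one_lt_two
      refine ⟨n, ?_, ?_⟩
      · have := (le_div_iff₀ hR0).1 hn1; linarith
      · have := (div_lt_iff₀ hR0).1 hn2; linarith
  -- per-shell bound
  set q : ℝ := (2 : ℝ) ^ (-a) with hq
  have hq0 : 0 < q := Real.rpow_pos_of_pos two_pos _
  have hq1 : q < 1 := Real.rpow_lt_one_of_one_lt_of_neg one_lt_two (by linarith)
  set K₀ : ℝ := C_E * (2 : ℝ) ^ (3 - a) * R ^ (-a) with hK₀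
  have hK₀0 : 0 ≤ K₀ := by positivity
  have hshell : ∀ j : ℕ, IntegrableOn w (T j) volume ∧ ∫ z in T j, w z ≤ K₀ * q ^ j := by
    intro j
    set ρ : ℝ := 2 ^ j * R with hρ
    have hρ0 : 0 < ρ := by positivity
    have hK : IsCompact {z : EuclideanSpace ℝ (Fin 3) | ρ ≤ ‖z‖ ∧ ‖z‖ ≤ 2 * ρ} := by
      refine (isCompact_closedBall (0 : EuclideanSpace ℝ (Fin 3)) (2 * ρ)).of_isClosed_subset
        ((isClosed_le continuous_const continuous_norm).inter
          (isClosed_le continuous_norm continuous_const)) fun z hz => ?_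
      rw [mem_closedBall_zero_iff]; exact hz.2
    have hcont : ContinuousOn w {z : EuclideanSpace ℝ (Fin 3) | ρ ≤ ‖z‖ ∧ ‖z‖ ≤ 2 * ρ} :=
      ((hU.norm.pow 2).continuousOn).div (continuous_norm.pow 3).continuousOn fun z hz =>
        (pow_pos (hρ0.trans_le hz.1) 3).ne'
    have hTsub : T j ⊆ {z : EuclideanSpace ℝ (Fin 3) | ρ ≤ ‖z‖ ∧ ‖z‖ ≤ 2 * ρ} := fun z hz =>
      ⟨hz.1, by rw [hρ]; have := hz.2; rw [pow_succ] at this; linarith⟩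
    have hint : IntegrableOn w (T j) volume := (hcont.integrableOn_compact hK).mono_set hTsub
    refine ⟨hint, ?_⟩
    -- `∫_{T_j} w ≤ ρ⁻³ ∫_{T_j} |U|² ≤ ρ⁻³ ∫_{B_{2ρ}} |U|² ≤ ρ⁻³ C_E (2ρ)^{3−a}`
    have hU2i : IntegrableOn (fun z => ‖U z‖ ^ 2) (ball (0 : EuclideanSpace ℝ (Fin 3)) (2 * ρ)) volume :=
      integrableOn_of_continuous_isBounded (hU.norm.pow 2) isBounded_ball
    have hTball : T j ⊆ ball (0 : EuclideanSpace ℝ (Fin 3)) (2 * ρ) := fun z hz => by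
      rw [mem_ball_zero_iff, hρ]; have := hz.2; rw [pow_succ] at this; linarith
    have h1 : ∫ z in T j, w z ≤ ∫ z in T j, ρ⁻¹ ^ 3 * ‖U z‖ ^ 2 := by
      refine setIntegral_mono_on hint ((hU2i.mono_set hTball).const_mul _) (hTm j) fun z hz => ?_
      have hz0 : 0 < ‖z‖ := hρ0.trans_le hz.1
      rw [hw]; dsimp only
      rw [div_eq_mul_inv, mul_comm, ← inv_pow]
      gcongr
      exact hz.1
    have h2 : ∫ z in T j, ρ⁻¹ ^ 3 * ‖U z‖ ^ 2 ≤ ρ⁻¹ ^ 3 * (C_E * (2 * ρ) ^ (3 - a)) := by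
      rw [integral_const_mul]
      refine mul_le_mul_of_nonneg_left ?_ (by positivity)
      calc ∫ z in T j, ‖U z‖ ^ 2 ≤ ∫ z in ball (0 : EuclideanSpace ℝ (Fin 3)) (2 * ρ), ‖U z‖ ^ 2 :=
            setIntegral_mono_set hU2i (Eventually.of_forall fun _ => sq_nonneg _)
              (Eventually.of_forall hTball)
        _ ≤ C_E * (2 * ρ) ^ (3 - a) := hE _ (by
            rw [hρ]
            have : R ≤ 2 ^ j * R := le_mul_of_one_le_left hR0.le (one_le_pow₀ one_le_two)
            linarith)
    have h3 : ρ⁻¹ ^ 3 * (C_E * (2 * ρ) ^ (3 - a)) = K₀ * q ^ j := by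
      rw [hK₀, hq, hρ, ← two_pow_rpow_comm (-a) j, Real.mul_rpow (by positivity) (by positivity),
        Real.mul_rpow (by positivity) hR0.le, mul_inv, mul_pow]
      have e1 : ((2 : ℝ) ^ j)⁻¹ ^ 3 * ((2 : ℝ) ^ j) ^ (3 - a) = ((2 : ℝ) ^ j) ^ (-a) := by
        rw [← Real.rpow_neg_one, ← Real.rpow_natCast, ← Real.rpow_mul (by positivity),
          ← Real.rpow_add (by positivity)]
        norm_num; ring_nf
      have e2 : R⁻¹ ^ 3 * R ^ (3 - a) = R ^ (-a) := by
        rw [← Real.rpow_neg_one, ← Real.rpow_natCast, ← Real.rpow_mul hR0.le, ← Real.rpow_add hR0]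
        norm_num; ring_nf
      calc ((2 : ℝ) ^ j)⁻¹ ^ 3 * R⁻¹ ^ 3 * (C_E * ((2 : ℝ) ^ (3 - a) * (((2 : ℝ) ^ j) ^ (3 - a) * R ^ (3 - a))))
          = C_E * (2 : ℝ) ^ (3 - a) * (R⁻¹ ^ 3 * R ^ (3 - a)) * (((2 : ℝ) ^ j)⁻¹ ^ 3 * ((2 : ℝ) ^ j) ^ (3 - a)) := by
            ring
        _ = C_E * (2 : ℝ) ^ (3 - a) * R ^ (-a) * ((2 : ℝ) ^ j) ^ (-a) := by rw [e1, e2]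
    linarith [h1, h2, h3.le]
  -- the lower integral over the whole far region
  have hgeom : HasSum (fun j : ℕ => K₀ * q ^ j) (K₀ * (1 - q)⁻¹) :=
    (hasSum_geometric_of_lt_one hq0.le hq1).mul_left K₀
  have hlin : ∫⁻ z in {z : EuclideanSpace ℝ (Fin 3) | R ≤ ‖z‖}, ENNReal.ofReal (w z) ≤
      ENNReal.ofReal (K₀ * (1 - q)⁻¹) := by
    rw [← hTunion, lintegral_iUnion hTm hTdisj]
    have hterm : ∀ j, ∫⁻ z in T j, ENNReal.ofReal (w z) ≤ ENNReal.ofReal (K₀ * q ^ j) := by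
      intro j
      rw [← ofReal_integral_eq_lintegral_ofReal (hshell j).1 (Eventually.of_forall hw0)]
      exact ENNReal.ofReal_le_ofReal (hshell j).2
    calc ∑' j, ∫⁻ z in T j, ENNReal.ofReal (w z) ≤ ∑' j, ENNReal.ofReal (K₀ * q ^ j) :=
          ENNReal.tsum_le_tsum hterm
      _ = ENNReal.ofReal (K₀ * (1 - q)⁻¹) := by
          rw [← ENNReal.ofReal_tsum_of_nonneg (fun j => by positivity) hgeom.summable, hgeom.tsum_eq]
  have hmS : MeasurableSet {z : EuclideanSpace ℝ (Fin 3) | R ≤ ‖z‖} :=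
    (isClosed_le continuous_const continuous_norm).measurableSet
  have hint : IntegrableOn w {z : EuclideanSpace ℝ (Fin 3) | R ≤ ‖z‖} volume := by
    refine ⟨hwm.aestronglyMeasurable.restrict, ?_⟩
    rw [HasFiniteIntegral]
    have e : ∀ z, ‖w z‖ₑ = ENNReal.ofReal (w z) := fun z => Real.enorm_eq_ofReal (hw0 z)
    simp_rw [e]
    exact hlin.trans_lt ENNReal.ofReal_lt_top
  refine ⟨hint, ?_⟩
  rw [integral_eq_lintegral_of_nonneg_ae (Eventually.of_forall hw0) hint.aestronglyMeasurable]
  have := ENNReal.toReal_le_of_le_ofReal (by positivity) hlin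
  calc (∫⁻ z in {z : EuclideanSpace ℝ (Fin 3) | R ≤ ‖z‖}, ENNReal.ofReal (w z)).toReal
      ≤ K₀ * (1 - q)⁻¹ := this
    _ = C_E * (2 : ℝ) ^ (3 - a) * (1 - (2 : ℝ) ^ (-a))⁻¹ * R ^ (-a) := by rw [hK₀, hq]; ring

/-! ## §2 One dyadic shell: the `L³` rate, the pressure rate, the flux rate

Throughout, "`F(M) ≤ C M^p` for `M ≥ M₀`" is a RATE; BS15 §3 tracks the rates of the shell
averages `⟨|v|²⟩ ≲ L^{−a}`, `⟨|v|³⟩ ≲ L^{−b}` (here un-averaged: `∫_{S_L}|v|² ≲ L^{3−a}`,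
`∫_{S_L}|v|³ ≲ L^{3−b}`). -/

/-- **Interpolated `L³` shell rate** (BS15 §3: "`⟨|v|³⟩_{L,2L} ≲ L^{−(θa₀ + (1−θ)c)}`"): from the
ball-energy rate `∫_{|y|<L}|U|² ≤ C_E L^{3−a}` (`L ≥ L_E > 0`) and the shell growth
`∫_{L<|y|<2L}|U|^r ≤ C₂ L^γ` (`L ≥ L₂`), for `M ≥ max L_E L₂`:
`∫_{S_M} |U|³ ≤ C_E^θ 2^{(3−a)θ} C₂^{1−θ} M^{(3−a)θ + γ(1−θ)}`, `θ = (r−3)/(r−2)`.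
[cite: BronziShvydkoy2015, §3 (proof of Thm. 1.1, bootstrap: interpolation step)] -/
theorem shell_L3_rate {U : EuclideanSpace ℝ (Fin 3) → EuclideanSpace ℝ (Fin 3)} (hU : Continuous U)
    {r γ a C_E C₂ L_E L₂ : ℝ} (hr : 3 ≤ r) (hCE : 0 ≤ C_E) (hC₂ : 0 ≤ C₂) (hLE : 0 < L_E)
    (hE : ∀ L : ℝ, L_E ≤ L →
      ∫ y in ball (0 : EuclideanSpace ℝ (Fin 3)) L, ‖U y‖ ^ 2 ≤ C_E * L ^ (3 - a))
    (hS : ∀ L : ℝ, L₂ ≤ L →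
      ∫ y in {y : EuclideanSpace ℝ (Fin 3) | L < ‖y‖ ∧ ‖y‖ < 2 * L}, ‖U y‖ ^ r ≤ C₂ * L ^ γ)
    {M : ℝ} (hM : max L_E L₂ ≤ M) :
    ∫ y in {y : EuclideanSpace ℝ (Fin 3) | M < ‖y‖ ∧ ‖y‖ < 2 * M}, ‖U y‖ ^ (3 : ℝ) ≤
      (C_E ^ ((r - 3) / (r - 2)) * (2 : ℝ) ^ ((3 - a) * ((r - 3) / (r - 2))) *
          C₂ ^ (1 - (r - 3) / (r - 2))) *
        M ^ ((3 - a) * ((r - 3) / (r - 2)) + γ * (1 - (r - 3) / (r - 2))) := by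
  set θ : ℝ := (r - 3) / (r - 2) with hθ
  have hM0 : 0 < M := hLE.trans_le ((le_max_left _ _).trans hM)
  have hr2 : 0 < r - 2 := by linarith
  have hθ0 : 0 ≤ θ := div_nonneg (by linarith) hr2.le
  have hθ1 : θ ≤ 1 := (div_le_one hr2).2 (by linarith)
  have h1θ : 0 ≤ 1 - θ := by linarith
  have hint := setIntegral_norm_rpow_three_le_interpolation hU (isBounded_shell M) hr
  -- the two shell bounds
  have hE2 : ∫ y in {y : EuclideanSpace ℝ (Fin 3) | M < ‖y‖ ∧ ‖y‖ < 2 * M}, ‖U y‖ ^ 2 ≤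
      C_E * (2 * M) ^ (3 - a) :=
    (setIntegral_shell_le_ball (hU.norm.pow 2) (fun _ => sq_nonneg _) M).trans
      (hE _ (by linarith [(le_max_left L_E L₂).trans hM]))
  have hEr := hS M ((le_max_right _ _).trans hM)
  have hX0 : 0 ≤ ∫ y in {y : EuclideanSpace ℝ (Fin 3) | M < ‖y‖ ∧ ‖y‖ < 2 * M}, ‖U y‖ ^ 2 :=
    integral_nonneg fun _ => sq_nonneg _
  have hR0 : 0 ≤ ∫ y in {y : EuclideanSpace ℝ (Fin 3) | M < ‖y‖ ∧ ‖y‖ < 2 * M}, ‖U y‖ ^ r :=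
    integral_nonneg fun _ => Real.rpow_nonneg (norm_nonneg _) _
  calc ∫ y in {y : EuclideanSpace ℝ (Fin 3) | M < ‖y‖ ∧ ‖y‖ < 2 * M}, ‖U y‖ ^ (3 : ℝ)
      ≤ (∫ y in {y : EuclideanSpace ℝ (Fin 3) | M < ‖y‖ ∧ ‖y‖ < 2 * M}, ‖U y‖ ^ 2) ^ θ *
          (∫ y in {y : EuclideanSpace ℝ (Fin 3) | M < ‖y‖ ∧ ‖y‖ < 2 * M}, ‖U y‖ ^ r) ^ (1 - θ) := hint
    _ ≤ (C_E * (2 * M) ^ (3 - a)) ^ θ * (C₂ * M ^ γ) ^ (1 - θ) := by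
        gcongr
    _ = (C_E ^ θ * (2 : ℝ) ^ ((3 - a) * θ) * C₂ ^ (1 - θ)) * M ^ ((3 - a) * θ + γ * (1 - θ)) := by
        rw [Real.mul_rpow hCE (by positivity), Real.mul_rpow hC₂ (by positivity),
          Real.mul_rpow (by norm_num) hM0.le, Real.mul_rpow (by positivity) (by positivity),
          ← Real.rpow_mul (by norm_num), ← Real.rpow_mul hM0.le, ← Real.rpow_mul hM0.le,
          Real.rpow_add hM0]
        ring

/-- Sum of one rate over the three shells of the annulus `{M/2 ≤ |y| < 4M}`:
`(M/2)^p + M^p + (2M)^p = ((1/2)^p + 1 + 2^p) M^p`. [folklore] -/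
private theorem three_scales_rpow {M : ℝ} (hM : 0 < M) (p : ℝ) :
    (M / 2) ^ p + M ^ p + (2 * M) ^ p = ((1 / 2 : ℝ) ^ p + 1 + (2 : ℝ) ^ p) * M ^ p := by
  rw [div_eq_mul_one_div, Real.mul_rpow hM.le (by norm_num), Real.mul_rpow (by norm_num) hM.le]
  ring

/-- **The pressure rate on a shell** (BS15 §3, "as a consequence of (2.4)": the pressure term of
the two-scale inequality is controlled by the `L³` rate and the energy rate): from the dyadic
pressure law (2.4) (`L ≥ L₃`), the `L³` shell rate `∫_{S_L}|U|³ ≤ C₃ L^{p₃}` (`L ≥ M₁ > 0`) and the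
ball-energy rate `∫_{|y|<L}|U|² ≤ C_E L^{3−a}` (`L ≥ L_E > 0`, `a > 0`), for
`M ≥ 2 max (max L_E M₁) L₃`:
`(∫_{S_M}|P|^{3/2})^{2/3} ≤ K (C₃ c)^{2/3} M^{(2/3)p₃} + K (C_E (1/2)^{3−a} + C_W 4^{−a}) M^{2−a}`,
`c = (1/2)^{p₃} + 1 + 2^{p₃}`, `C_W = C_E 2^{3−a}(1 − 2^{−a})⁻¹`.
[cite: BronziShvydkoy2015, §3 (proof of Thm. 1.1, display (3.1) "as a consequence of (2.4)")] -/
theorem shell_pressure_rate {U : EuclideanSpace ℝ (Fin 3) → EuclideanSpace ℝ (Fin 3)}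
    {P : EuclideanSpace ℝ (Fin 3) → ℝ} (hU : Continuous U)
    {a p₃ C_E C₃ K L_E M₁ L₃ : ℝ} (ha : 0 < a) (hCE : 0 ≤ C_E) (hC₃ : 0 ≤ C₃) (hK : 0 ≤ K)
    (hLE : 0 < L_E)
    (hE : ∀ L : ℝ, L_E ≤ L →
      ∫ y in ball (0 : EuclideanSpace ℝ (Fin 3)) L, ‖U y‖ ^ 2 ≤ C_E * L ^ (3 - a))
    (hX3 : ∀ L : ℝ, M₁ ≤ L →
      ∫ y in {y : EuclideanSpace ℝ (Fin 3) | L < ‖y‖ ∧ ‖y‖ < 2 * L}, ‖U y‖ ^ (3 : ℝ) ≤ C₃ * L ^ p₃)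
    (hPl : ∀ L : ℝ, L₃ ≤ L →
      (∫ y in {y : EuclideanSpace ℝ (Fin 3) | L < ‖y‖ ∧ ‖y‖ < 2 * L}, |P y| ^ (3 / 2 : ℝ)) ^ (2 / 3 : ℝ) ≤
        K * ((∫ z in {z : EuclideanSpace ℝ (Fin 3) | L / 2 ≤ ‖z‖ ∧ ‖z‖ < 4 * L}, ‖U z‖ ^ (3 : ℝ)) ^ (2 / 3 : ℝ) +
          L ^ 2 * (L⁻¹ ^ 3 * (∫ z in ball (0 : EuclideanSpace ℝ (Fin 3)) (L / 2), ‖U z‖ ^ 2) +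
            ∫ z in {z : EuclideanSpace ℝ (Fin 3) | 4 * L ≤ ‖z‖}, ‖U z‖ ^ 2 / ‖z‖ ^ 3)))
    {M : ℝ} (hM : 2 * max (max L_E M₁) L₃ ≤ M) :
    (∫ y in {y : EuclideanSpace ℝ (Fin 3) | M < ‖y‖ ∧ ‖y‖ < 2 * M}, |P y| ^ (3 / 2 : ℝ)) ^ (2 / 3 : ℝ) ≤
      K * (C₃ * ((1 / 2 : ℝ) ^ p₃ + 1 + (2 : ℝ) ^ p₃)) ^ (2 / 3 : ℝ) * M ^ (2 / 3 * p₃) +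
        K * (C_E * (1 / 2 : ℝ) ^ (3 - a) + C_E * (2 : ℝ) ^ (3 - a) * (1 - (2 : ℝ) ^ (-a))⁻¹ * (4 : ℝ) ^ (-a)) *
          M ^ (2 - a) := by
  have hmax : max (max L_E M₁) L₃ ≤ M / 2 := by linarith
  have hLEM : L_E ≤ M / 2 := ((le_max_left _ _).trans (le_max_left _ _)).trans hmax
  have hM₁M : M₁ ≤ M / 2 := ((le_max_right _ _).trans (le_max_left _ _)).trans hmax
  have hL₃M : L₃ ≤ M := by linarith [(le_max_right (max L_E M₁) L₃).trans hmax]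
  have hM0 : 0 < M := by linarith
  set c : ℝ := (1 / 2 : ℝ) ^ p₃ + 1 + (2 : ℝ) ^ p₃ with hc
  have hc0 : 0 ≤ c := by positivity
  -- the annulus `L³` integral by three shells
  have hA3 : ∫ z in {z : EuclideanSpace ℝ (Fin 3) | M / 2 ≤ ‖z‖ ∧ ‖z‖ < 4 * M}, ‖U z‖ ^ (3 : ℝ) ≤
      C₃ * c * M ^ p₃ := by
    rw [setIntegral_annulus_eq_three_shells (hU.norm.rpow_const fun _ => Or.inr (by norm_num)) hM0]
    have h1 := hX3 (M / 2) hM₁M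
    have h2 := hX3 M (by linarith)
    have h3 := hX3 (2 * M) (by linarith)
    calc (∫ y in {y : EuclideanSpace ℝ (Fin 3) | M / 2 < ‖y‖ ∧ ‖y‖ < 2 * (M / 2)}, ‖U y‖ ^ (3 : ℝ)) +
          (∫ y in {y : EuclideanSpace ℝ (Fin 3) | M < ‖y‖ ∧ ‖y‖ < 2 * M}, ‖U y‖ ^ (3 : ℝ)) +
          ∫ y in {y : EuclideanSpace ℝ (Fin 3) | 2 * M < ‖y‖ ∧ ‖y‖ < 2 * (2 * M)}, ‖U y‖ ^ (3 : ℝ)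
        ≤ C₃ * (M / 2) ^ p₃ + C₃ * M ^ p₃ + C₃ * (2 * M) ^ p₃ := by linarith
      _ = C₃ * c * M ^ p₃ := by
          have := three_scales_rpow hM0 p₃
          rw [hc]
          linear_combination C₃ * this
  -- the inner ball
  have hinner : M⁻¹ ^ 3 * ∫ z in ball (0 : EuclideanSpace ℝ (Fin 3)) (M / 2), ‖U z‖ ^ 2 ≤
      C_E * (1 / 2 : ℝ) ^ (3 - a) * M ^ (-a) := by
    have h1 := hE (M / 2) hLEM
    have e : M⁻¹ ^ 3 * (C_E * (M / 2) ^ (3 - a)) = C_E * (1 / 2 : ℝ) ^ (3 - a) * M ^ (-a) := by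
      rw [div_eq_mul_one_div, Real.mul_rpow hM0.le (by norm_num), ← Real.rpow_neg_one,
        ← Real.rpow_natCast, ← Real.rpow_mul hM0.le]
      have e' : M ^ ((-1 : ℝ) * ((3 : ℕ) : ℝ)) * M ^ (3 - a) = M ^ (-a) := by
        rw [← Real.rpow_add hM0]; norm_num; ring_nf
      calc M ^ ((-1 : ℝ) * ((3 : ℕ) : ℝ)) * (C_E * (M ^ (3 - a) * (1 / 2 : ℝ) ^ (3 - a)))
          = C_E * (1 / 2 : ℝ) ^ (3 - a) * (M ^ ((-1 : ℝ) * ((3 : ℕ) : ℝ)) * M ^ (3 - a)) := by ring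
        _ = _ := by rw [e']
    calc M⁻¹ ^ 3 * ∫ z in ball (0 : EuclideanSpace ℝ (Fin 3)) (M / 2), ‖U z‖ ^ 2
        ≤ M⁻¹ ^ 3 * (C_E * (M / 2) ^ (3 - a)) := mul_le_mul_of_nonneg_left h1 (by positivity)
      _ = _ := e
  -- the far weight
  have hfar := (farWeight_integrableOn_and_le hU ha hCE hLE hE (R := 4 * M) (by linarith)).2
  have hfar' : ∫ z in {z : EuclideanSpace ℝ (Fin 3) | 4 * M ≤ ‖z‖}, ‖U z‖ ^ 2 / ‖z‖ ^ 3 ≤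
      C_E * (2 : ℝ) ^ (3 - a) * (1 - (2 : ℝ) ^ (-a))⁻¹ * (4 : ℝ) ^ (-a) * M ^ (-a) := by
    rw [Real.mul_rpow (by norm_num) hM0.le] at hfar
    linarith [hfar]
  -- assemble
  have hPM := hPl M hL₃M
  have h23 : (0 : ℝ) ≤ 2 / 3 := by norm_num
  have hA23 : (∫ z in {z : EuclideanSpace ℝ (Fin 3) | M / 2 ≤ ‖z‖ ∧ ‖z‖ < 4 * M}, ‖U z‖ ^ (3 : ℝ)) ^ (2 / 3 : ℝ) ≤
      (C₃ * c) ^ (2 / 3 : ℝ) * M ^ (2 / 3 * p₃) := by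
    calc (∫ z in {z : EuclideanSpace ℝ (Fin 3) | M / 2 ≤ ‖z‖ ∧ ‖z‖ < 4 * M}, ‖U z‖ ^ (3 : ℝ)) ^ (2 / 3 : ℝ)
        ≤ (C₃ * c * M ^ p₃) ^ (2 / 3 : ℝ) :=
          Real.rpow_le_rpow (setIntegral_norm_rpow_three_nonneg U _) hA3 h23
      _ = (C₃ * c) ^ (2 / 3 : ℝ) * M ^ (2 / 3 * p₃) := by
          rw [Real.mul_rpow (by positivity) (by positivity), ← Real.rpow_mul hM0.le, mul_comm p₃]
  have hM2 : M ^ 2 * M ^ (-a) = M ^ (2 - a) := by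
    rw [← Real.rpow_natCast M 2, ← Real.rpow_add hM0]; norm_num
    ring_nf
  have hW0 : 0 ≤ (1 - (2 : ℝ) ^ (-a))⁻¹ := by
    have : (2 : ℝ) ^ (-a) < 1 := Real.rpow_lt_one_of_one_lt_of_neg one_lt_two (by linarith)
    exact inv_nonneg.2 (by linarith)
  calc (∫ y in {y : EuclideanSpace ℝ (Fin 3) | M < ‖y‖ ∧ ‖y‖ < 2 * M}, |P y| ^ (3 / 2 : ℝ)) ^ (2 / 3 : ℝ)
      ≤ K * ((∫ z in {z : EuclideanSpace ℝ (Fin 3) | M / 2 ≤ ‖z‖ ∧ ‖z‖ < 4 * M}, ‖U z‖ ^ (3 : ℝ)) ^ (2 / 3 : ℝ) +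
          M ^ 2 * (M⁻¹ ^ 3 * (∫ z in ball (0 : EuclideanSpace ℝ (Fin 3)) (M / 2), ‖U z‖ ^ 2) +
            ∫ z in {z : EuclideanSpace ℝ (Fin 3) | 4 * M ≤ ‖z‖}, ‖U z‖ ^ 2 / ‖z‖ ^ 3)) := hPM
    _ ≤ K * ((C₃ * c) ^ (2 / 3 : ℝ) * M ^ (2 / 3 * p₃) +
          M ^ 2 * (C_E * (1 / 2 : ℝ) ^ (3 - a) * M ^ (-a) +
            C_E * (2 : ℝ) ^ (3 - a) * (1 - (2 : ℝ) ^ (-a))⁻¹ * (4 : ℝ) ^ (-a) * M ^ (-a))) := by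
        gcongr
    _ = K * (C₃ * c) ^ (2 / 3 : ℝ) * M ^ (2 / 3 * p₃) +
        K * (C_E * (1 / 2 : ℝ) ^ (3 - a) + C_E * (2 : ℝ) ^ (3 - a) * (1 - (2 : ℝ) ^ (-a))⁻¹ * (4 : ℝ) ^ (-a)) *
          (M ^ 2 * M ^ (-a)) := by ring
    _ = _ := by rw [hM2]

/-- **The flux rate on a shell** (BS15 §3: the right-hand side of (3.1) has rate
`min(b, b/3 + a)`): if `∫_{S_L}|U|³ ≤ C₃ L^{p₃}` and
`(∫_{S_L}|P|^{3/2})^{2/3} ≤ C_Y L^{q₁} + C_Y' L^{q₂}` for `L ≥ M₁`, then for `M ≥ max M₁ 1` and any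
`e ≥ p₃, q₁ + p₃/3, q₂ + p₃/3`:
`∫_{S_M} (|U|³ + 2|P||U|) ≤ (C₃ + 2 C_Y C₃^{1/3} + 2 C_Y' C₃^{1/3}) M^e`
(Hölder `∫|P||U| ≤ (∫|P|^{3/2})^{2/3}(∫|U|³)^{1/3}`).
[cite: BronziShvydkoy2015, §3 (proof of Thm. 1.1, display (3.1) and the rule for a₁)] -/
theorem shell_flux_rate {U : EuclideanSpace ℝ (Fin 3) → EuclideanSpace ℝ (Fin 3)}
    {P : EuclideanSpace ℝ (Fin 3) → ℝ} (hU : Continuous U) (hP : Continuous P)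
    {p₃ q₁ q₂ e C₃ C_Y C_Y' M₁ : ℝ} (hC₃ : 0 ≤ C₃) (hCY : 0 ≤ C_Y) (hCY' : 0 ≤ C_Y')
    (he₁ : p₃ ≤ e) (he₂ : q₁ + p₃ / 3 ≤ e) (he₃ : q₂ + p₃ / 3 ≤ e)
    (hX3 : ∀ L : ℝ, M₁ ≤ L →
      ∫ y in {y : EuclideanSpace ℝ (Fin 3) | L < ‖y‖ ∧ ‖y‖ < 2 * L}, ‖U y‖ ^ (3 : ℝ) ≤ C₃ * L ^ p₃)
    (hY : ∀ L : ℝ, M₁ ≤ L →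
      (∫ y in {y : EuclideanSpace ℝ (Fin 3) | L < ‖y‖ ∧ ‖y‖ < 2 * L}, |P y| ^ (3 / 2 : ℝ)) ^ (2 / 3 : ℝ) ≤
        C_Y * L ^ q₁ + C_Y' * L ^ q₂)
    {M : ℝ} (hM : max M₁ 1 ≤ M) :
    ∫ y in {y : EuclideanSpace ℝ (Fin 3) | M < ‖y‖ ∧ ‖y‖ < 2 * M}, (‖U y‖ ^ 3 + 2 * (|P y| * ‖U y‖)) ≤
      (C₃ + 2 * C_Y * C₃ ^ (1 / 3 : ℝ) + 2 * C_Y' * C₃ ^ (1 / 3 : ℝ)) * M ^ e := by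
  have hM1 : 1 ≤ M := (le_max_right _ _).trans hM
  have hM0 : 0 < M := by linarith
  have hM₁M : M₁ ≤ M := (le_max_left _ _).trans hM
  set S : Set (EuclideanSpace ℝ (Fin 3)) := {y | M < ‖y‖ ∧ ‖y‖ < 2 * M} with hS
  have hSb : Bornology.IsBounded S := isBounded_shell M
  -- split the integral
  have hi3 : IntegrableOn (fun y => ‖U y‖ ^ 3) S volume :=
    integrableOn_of_continuous_isBounded (hU.norm.pow 3) hSb
  have hiPU : IntegrableOn (fun y => 2 * (|P y| * ‖U y‖)) S volume :=
    (integrableOn_of_continuous_isBounded ((continuous_abs.comp hP).mul hU.norm) hSb).const_mul 2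
  rw [integral_add hi3 hiPU, integral_const_mul]
  -- the cubic term
  have e3 : ∫ y in S, ‖U y‖ ^ 3 = ∫ y in S, ‖U y‖ ^ (3 : ℝ) := by
    refine integral_congr_ae (Eventually.of_forall fun y => ?_)
    exact (Real.rpow_natCast (‖U y‖) 3).symm
  have hX := hX3 M hM₁M
  have hX0 : 0 ≤ ∫ y in S, ‖U y‖ ^ (3 : ℝ) := setIntegral_norm_rpow_three_nonneg U S
  -- Hölder for the pressure term
  have hH := setIntegral_mul_norm_le_rpow hP hU hSb
  have hYM := hY M hM₁M
  have hI0 : 0 ≤ (∫ y in S, |P y| ^ (3 / 2 : ℝ)) :=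
    integral_nonneg fun _ => Real.rpow_nonneg (abs_nonneg _) _
  have e23 : (1 / (3 / 2) : ℝ) = 2 / 3 := by norm_num
  rw [e23] at hH
  have hX13 : (∫ y in S, ‖U y‖ ^ (3 : ℝ)) ^ (1 / 3 : ℝ) ≤ (C₃ * M ^ p₃) ^ (1 / 3 : ℝ) :=
    Real.rpow_le_rpow hX0 hX (by norm_num)
  have hX13' : (C₃ * M ^ p₃) ^ (1 / 3 : ℝ) = C₃ ^ (1 / 3 : ℝ) * M ^ (p₃ / 3) := by
    rw [Real.mul_rpow hC₃ (by positivity), ← Real.rpow_mul hM0.le]; ring_nf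
  -- compare powers of `M ≥ 1`
  have hp1 : M ^ p₃ ≤ M ^ e := Real.rpow_le_rpow_of_exponent_le hM1 he₁
  have hp2 : M ^ q₁ * M ^ (p₃ / 3) ≤ M ^ e := by
    rw [← Real.rpow_add hM0]; exact Real.rpow_le_rpow_of_exponent_le hM1 he₂
  have hp3 : M ^ q₂ * M ^ (p₃ / 3) ≤ M ^ e := by
    rw [← Real.rpow_add hM0]; exact Real.rpow_le_rpow_of_exponent_le hM1 he₃
  have hPU : ∫ y in S, |P y| * ‖U y‖ ≤ (C_Y * M ^ q₁ + C_Y' * M ^ q₂) * (C₃ ^ (1 / 3 : ℝ) * M ^ (p₃ / 3)) := by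
    calc ∫ y in S, |P y| * ‖U y‖
        ≤ (∫ y in S, |P y| ^ (3 / 2 : ℝ)) ^ (2 / 3 : ℝ) * (∫ y in S, ‖U y‖ ^ (3 : ℝ)) ^ (1 / 3 : ℝ) := hH
      _ ≤ (C_Y * M ^ q₁ + C_Y' * M ^ q₂) * (C₃ * M ^ p₃) ^ (1 / 3 : ℝ) := by
          gcongr
      _ = _ := by rw [hX13']
  have hC13 : 0 ≤ C₃ ^ (1 / 3 : ℝ) := Real.rpow_nonneg hC₃ _
  calc (∫ y in S, ‖U y‖ ^ 3) + 2 * ∫ y in S, |P y| * ‖U y‖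
      ≤ C₃ * M ^ p₃ + 2 * ((C_Y * M ^ q₁ + C_Y' * M ^ q₂) * (C₃ ^ (1 / 3 : ℝ) * M ^ (p₃ / 3))) := by
        rw [e3]; linarith
    _ = C₃ * M ^ p₃ + 2 * C_Y * C₃ ^ (1 / 3 : ℝ) * (M ^ q₁ * M ^ (p₃ / 3)) +
        2 * C_Y' * C₃ ^ (1 / 3 : ℝ) * (M ^ q₂ * M ^ (p₃ / 3)) := by ring
    _ ≤ C₃ * M ^ e + 2 * C_Y * C₃ ^ (1 / 3 : ℝ) * M ^ e + 2 * C_Y' * C₃ ^ (1 / 3 : ℝ) * M ^ e := by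
        gcongr
    _ = (C₃ + 2 * C_Y * C₃ ^ (1 / 3 : ℝ) + 2 * C_Y' * C₃ ^ (1 / 3 : ℝ)) * M ^ e := by ring

/-! ## §3 The dyadic flux sums and one bootstrap step -/

/-- Chae–Shvydkoy's closed dyadic shell `{M²/2 ≤ |y|² ≤ 4M²}` lies inside the annulus
`{M/2 ≤ |y| < 4M}`. [folklore] -/
private theorem csShell_subset_annulus {M : ℝ} (hM : 0 < M) :
    {y : EuclideanSpace ℝ (Fin 3) | M ^ 2 / 2 ≤ ‖y‖ ^ 2 ∧ ‖y‖ ^ 2 ≤ 4 * M ^ 2} ⊆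
      {y : EuclideanSpace ℝ (Fin 3) | M / 2 ≤ ‖y‖ ∧ ‖y‖ < 4 * M} := by
  rintro y ⟨h1, h2⟩
  have hy0 : 0 ≤ ‖y‖ := norm_nonneg _
  constructor
  · have h3 : (M / 2) ^ 2 ≤ ‖y‖ ^ 2 := by nlinarith
    exact (pow_le_pow_iff_left₀ (by positivity) hy0 two_ne_zero).1 h3
  · have h3 : ‖y‖ ^ 2 < (4 * M) ^ 2 := by nlinarith
    exact (pow_lt_pow_iff_left₀ hy0 (by positivity) two_ne_zero).1 h3

/-- **The dyadic weighted flux sums** (the quantity `B` of the tree's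
`twoScaleEnergy_le_dyadicFlux_of_frequently_small`): if `∫_{S_M}(|U|³ + 2|P||U|) ≤ C_s M^e`
for `M ≥ M_s > 0` and `s = 2α − 4 + e < 0`, then for `l ≥ 2M_s` and every `k`,
`Σ_{j<k} (2^j l)^{2α−4} ∫_{(2^jl)²/2≤|y|²≤4(2^jl)²} (|U|³ + 2|P||U|) ≤ C_s c_e (1 − 2^s)⁻¹ l^s`,
`c_e = (1/2)^e + 1 + 2^e`. [cite: BronziShvydkoy2015, §3 (proof of Thm. 1.1, display (3.1))] -/
theorem dyadicFluxSum_le {U : EuclideanSpace ℝ (Fin 3) → EuclideanSpace ℝ (Fin 3)}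
    {P : EuclideanSpace ℝ (Fin 3) → ℝ} (hU : Continuous U) (hP : Continuous P)
    {α e C_s M_s : ℝ} (hCs : 0 ≤ C_s) (hMs : 0 < M_s) (hs : 2 * α - 4 + e < 0)
    (hF : ∀ M : ℝ, M_s ≤ M →
      ∫ y in {y : EuclideanSpace ℝ (Fin 3) | M < ‖y‖ ∧ ‖y‖ < 2 * M}, (‖U y‖ ^ 3 + 2 * (|P y| * ‖U y‖)) ≤
        C_s * M ^ e)
    {l : ℝ} (hl : 2 * M_s ≤ l) (k : ℕ) :
    ∑ j ∈ Finset.range k, (2 ^ j * l) ^ (2 * α - 4) *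
        ∫ y in {y : EuclideanSpace ℝ (Fin 3) |
            (2 ^ j * l) ^ 2 / 2 ≤ ‖y‖ ^ 2 ∧ ‖y‖ ^ 2 ≤ 4 * (2 ^ j * l) ^ 2},
          (‖U y‖ ^ 3 + 2 * (|P y| * ‖U y‖)) ≤
      C_s * ((1 / 2 : ℝ) ^ e + 1 + (2 : ℝ) ^ e) * (1 - (2 : ℝ) ^ (2 * α - 4 + e))⁻¹ *
        l ^ (2 * α - 4 + e) := by
  have hl0 : 0 < l := by linarith
  set F : EuclideanSpace ℝ (Fin 3) → ℝ := fun y => ‖U y‖ ^ 3 + 2 * (|P y| * ‖U y‖) with hFdef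
  have hFc : Continuous F := (hU.norm.pow 3).add (((continuous_abs.comp hP).mul hU.norm).const_mul 2)
  have hF0 : ∀ y, 0 ≤ F y := fun y => by rw [hFdef]; positivity
  set c : ℝ := (1 / 2 : ℝ) ^ e + 1 + (2 : ℝ) ^ e with hc
  set σ : ℝ := 2 * α - 4 + e with hσ
  set q : ℝ := (2 : ℝ) ^ σ with hq
  have hq0 : 0 < q := Real.rpow_pos_of_pos two_pos _
  have hq1 : q < 1 := Real.rpow_lt_one_of_one_lt_of_neg one_lt_two hs
  -- one scale `M ≥ 2 M_s`: the closed CS shell is inside the annulus = three dyadic shells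
  have hone : ∀ M : ℝ, 2 * M_s ≤ M →
      ∫ y in {y : EuclideanSpace ℝ (Fin 3) | M ^ 2 / 2 ≤ ‖y‖ ^ 2 ∧ ‖y‖ ^ 2 ≤ 4 * M ^ 2}, F y ≤
        C_s * c * M ^ e := by
    intro M hM
    have hM0 : 0 < M := by linarith
    calc ∫ y in {y : EuclideanSpace ℝ (Fin 3) | M ^ 2 / 2 ≤ ‖y‖ ^ 2 ∧ ‖y‖ ^ 2 ≤ 4 * M ^ 2}, F y
        ≤ ∫ y in {y : EuclideanSpace ℝ (Fin 3) | M / 2 ≤ ‖y‖ ∧ ‖y‖ < 4 * M}, F y :=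
          setIntegral_mono_set (integrableOn_of_continuous_isBounded hFc (isBounded_annulus M))
            (Eventually.of_forall hF0) (Eventually.of_forall (csShell_subset_annulus hM0))
      _ = (∫ y in {y : EuclideanSpace ℝ (Fin 3) | M / 2 < ‖y‖ ∧ ‖y‖ < 2 * (M / 2)}, F y) +
            (∫ y in {y : EuclideanSpace ℝ (Fin 3) | M < ‖y‖ ∧ ‖y‖ < 2 * M}, F y) +
            ∫ y in {y : EuclideanSpace ℝ (Fin 3) | 2 * M < ‖y‖ ∧ ‖y‖ < 2 * (2 * M)}, F y :=
          setIntegral_annulus_eq_three_shells hFc hM0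
      _ ≤ C_s * (M / 2) ^ e + C_s * M ^ e + C_s * (2 * M) ^ e := by
          have h1 := hF (M / 2) (by linarith)
          have h2 := hF M (by linarith)
          have h3 := hF (2 * M) (by linarith)
          linarith
      _ = C_s * c * M ^ e := by
          have := three_scales_rpow hM0 e
          rw [hc]; linear_combination C_s * this
  -- each term of the sum
  have hterm : ∀ j : ℕ, (2 ^ j * l) ^ (2 * α - 4) *
      ∫ y in {y : EuclideanSpace ℝ (Fin 3) | (2 ^ j * l) ^ 2 / 2 ≤ ‖y‖ ^ 2 ∧ ‖y‖ ^ 2 ≤ 4 * (2 ^ j * l) ^ 2}, F y ≤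
      C_s * c * l ^ σ * q ^ j := by
    intro j
    have hMl : 2 * M_s ≤ 2 ^ j * l :=
      hl.trans (le_mul_of_one_le_left hl0.le (one_le_pow₀ one_le_two))
    have hM0 : 0 < (2 : ℝ) ^ j * l := by positivity
    calc (2 ^ j * l) ^ (2 * α - 4) *
          ∫ y in {y : EuclideanSpace ℝ (Fin 3) | (2 ^ j * l) ^ 2 / 2 ≤ ‖y‖ ^ 2 ∧ ‖y‖ ^ 2 ≤ 4 * (2 ^ j * l) ^ 2}, F y
        ≤ (2 ^ j * l) ^ (2 * α - 4) * (C_s * c * (2 ^ j * l) ^ e) :=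
          mul_le_mul_of_nonneg_left (hone _ hMl) (Real.rpow_nonneg hM0.le _)
      _ = C_s * c * ((2 ^ j * l) ^ (2 * α - 4) * (2 ^ j * l) ^ e) := by ring
      _ = C_s * c * l ^ σ * q ^ j := by
          rw [← Real.rpow_add hM0, Real.mul_rpow (by positivity) hl0.le, two_pow_rpow_comm, hσ]
          ring
  calc ∑ j ∈ Finset.range k, (2 ^ j * l) ^ (2 * α - 4) *
        ∫ y in {y : EuclideanSpace ℝ (Fin 3) | (2 ^ j * l) ^ 2 / 2 ≤ ‖y‖ ^ 2 ∧ ‖y‖ ^ 2 ≤ 4 * (2 ^ j * l) ^ 2}, F y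
      ≤ ∑ j ∈ Finset.range k, C_s * c * l ^ σ * q ^ j := Finset.sum_le_sum fun j _ => hterm j
    _ = C_s * c * l ^ σ * ∑ j ∈ Finset.range k, q ^ j := by rw [Finset.mul_sum]
    _ ≤ C_s * c * l ^ σ * (1 - q)⁻¹ :=
        mul_le_mul_of_nonneg_left (geom_partial_sum_le hq0.le hq1 k) (by positivity)
    _ = C_s * c * (1 - q)⁻¹ * l ^ σ := by ring

/-- **One bootstrap step** (BS15 §3: "plugging this into (3.1) we obtain a new decay rate for the
energy"): for a profile pair whose rescaled ball energies are frequently small, a shell flux rate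
`∫_{S_M}(|U|³ + 2|P||U|) ≤ C_s M^e` (`M ≥ M_s > 0`) with `2α − 4 + e < 0` gives the ball-energy
rate `∫_{|y|<L}|U|² ≤ C' L^{e−1}` for `L ≥ M_s`. [cite: BronziShvydkoy2015, §3 (proof of Thm. 1.1, the rule defining a₁)] -/
theorem _root_.Literature.Analysis.FluidPDE.IsSelfSimilarEulerProfile.energyRate_step {α : ℝ}
    {U : EuclideanSpace ℝ (Fin 3) → EuclideanSpace ℝ (Fin 3)} {P : EuclideanSpace ℝ (Fin 3) → ℝ}
    (h : IsSelfSimilarEulerProfile (1 / (α + 1)) 0 U P) (hα : -1 < α) (hα2 : α ≤ 3 / 2)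
    (hsmall : ∀ ε : ℝ, 0 < ε → ∀ M : ℝ, ∃ L : ℝ, M ≤ L ∧
      L ^ (2 * α - 3) * ∫ y in ball (0 : EuclideanSpace ℝ (Fin 3)) L, ‖U y‖ ^ 2 ≤ ε)
    {e C_s M_s : ℝ} (hCs : 0 ≤ C_s) (hMs : 0 < M_s) (hs : 2 * α - 4 + e < 0)
    (hF : ∀ M : ℝ, M_s ≤ M →
      ∫ y in {y : EuclideanSpace ℝ (Fin 3) | M < ‖y‖ ∧ ‖y‖ < 2 * M}, (‖U y‖ ^ 3 + 2 * (|P y| * ‖U y‖)) ≤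
        C_s * M ^ e) :
    ∃ C' : ℝ, 0 ≤ C' ∧ ∀ L : ℝ, M_s ≤ L →
      ∫ y in ball (0 : EuclideanSpace ℝ (Fin 3)) L, ‖U y‖ ^ 2 ≤ C' * L ^ (e - 1) := by
  have hUc : Continuous U := h.contDiff_velocity.continuous
  have hPc : Continuous P := h.contDiff_pressure.continuous
  obtain ⟨C, hC0, hC⟩ := h.twoScaleEnergy_le_dyadicFlux_of_frequently_small hα hα2 hsmall
  set c : ℝ := (1 / 2 : ℝ) ^ e + 1 + (2 : ℝ) ^ e with hc
  set D : ℝ := C_s * c * (1 - (2 : ℝ) ^ (2 * α - 4 + e))⁻¹ with hD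
  have hq1 : (2 : ℝ) ^ (2 * α - 4 + e) < 1 := Real.rpow_lt_one_of_one_lt_of_neg one_lt_two hs
  have hD0 : 0 ≤ D := by
    have : 0 ≤ (1 - (2 : ℝ) ^ (2 * α - 4 + e))⁻¹ := inv_nonneg.2 (by linarith)
    positivity
  refine ⟨C * D * (2 : ℝ) ^ (e - 1), by positivity, fun L hL => ?_⟩
  have hL0 : 0 < L := hMs.trans_le hL
  set l : ℝ := 2 * L with hl
  have hl0 : 0 < l := by positivity
  have hB := hC l hl0 (D * l ^ (2 * α - 4 + e)) fun k => by
    have := dyadicFluxSum_le hUc hPc hCs hMs hs hF (l := l) (by rw [hl]; linarith) k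
    rw [hD]; exact this
  have hl2 : l / 2 = L := by rw [hl]; ring
  rw [hl2] at hB
  -- divide by `l^{2α−3}`
  have hpos : 0 < l ^ (3 - 2 * α) := Real.rpow_pos_of_pos hl0 _
  have key : ∫ y in ball (0 : EuclideanSpace ℝ (Fin 3)) L, ‖U y‖ ^ 2 ≤
      l ^ (3 - 2 * α) * (C * (D * l ^ (2 * α - 4 + e))) := by
    have h1 := mul_le_mul_of_nonneg_left hB hpos.le
    have e1 : l ^ (3 - 2 * α) * (l ^ (2 * α - 3) * ∫ y in ball (0 : EuclideanSpace ℝ (Fin 3)) L, ‖U y‖ ^ 2) =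
        ∫ y in ball (0 : EuclideanSpace ℝ (Fin 3)) L, ‖U y‖ ^ 2 := by
      rw [← mul_assoc, ← Real.rpow_add hl0]; norm_num
    rw [e1] at h1
    exact h1
  have e2 : l ^ (3 - 2 * α) * (C * (D * l ^ (2 * α - 4 + e))) = C * D * (2 : ℝ) ^ (e - 1) * L ^ (e - 1) := by
    have e3 : l ^ (3 - 2 * α) * l ^ (2 * α - 4 + e) = l ^ (e - 1) := by
      rw [← Real.rpow_add hl0]; ring_nf
    have e4 : l ^ (e - 1) = (2 : ℝ) ^ (e - 1) * L ^ (e - 1) := by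
      rw [hl, Real.mul_rpow (by norm_num) hL0.le]
    calc l ^ (3 - 2 * α) * (C * (D * l ^ (2 * α - 4 + e)))
        = C * D * (l ^ (3 - 2 * α) * l ^ (2 * α - 4 + e)) := by ring
      _ = _ := by rw [e3, e4]; ring
  rw [e2] at key
  exact key

/-! ## §4 Claim 3.1: the recursion of rates, and the proof of Theorem 1.1 -/

/-- **The exponent bookkeeping of BS15 Claim 3.1, one step.** With `θ = (r−3)/(r−2)`,
`b = θa + (1−θ)(3−γ)`, `m = min(b, b/3 + a)`, `e = max(3 − m, 1/3)`, `δ = min((r−2−γ)/(r−2), 2/3)`: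
for `0 < α < 3/2`, `3 ≤ r`, `γ < r − 2`, `2α ≤ a ≤ 3` one has `2α − 4 + e < 0` (the dyadic sums
converge), `3 − b ≤ e`, `3 − a − b/3 ≤ e` (the flux rate is `e`) and `a + δ ≤ 4 − e` (the new energy
rate gains at least `δ > 0`).  Printed: "`a_{n+1} = b_n + 1` provided `(3/2)a_n ≥ b_n`, or otherwise
`a_{n+1} = (1/3)b_n + a_n + 1`". [cite: BronziShvydkoy2015, §3 Claim 3.1] -/
theorem claim31_step {α r γ a : ℝ} (hα : 0 < α) (hα2 : α < 3 / 2) (hr : 3 ≤ r) (hγ : γ < r - 2)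
    (ha : 2 * α ≤ a) (ha3 : a ≤ 3) :
    0 < min ((r - 2 - γ) / (r - 2)) (2 / 3) ∧
    2 * α - 4 + max (3 - min ((r - 3) / (r - 2) * a + (1 - (r - 3) / (r - 2)) * (3 - γ))
        (((r - 3) / (r - 2) * a + (1 - (r - 3) / (r - 2)) * (3 - γ)) / 3 + a)) (1 / 3) < 0 ∧
    3 - ((r - 3) / (r - 2) * a + (1 - (r - 3) / (r - 2)) * (3 - γ)) ≤
      max (3 - min ((r - 3) / (r - 2) * a + (1 - (r - 3) / (r - 2)) * (3 - γ))
        (((r - 3) / (r - 2) * a + (1 - (r - 3) / (r - 2)) * (3 - γ)) / 3 + a)) (1 / 3) ∧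
    3 - a - ((r - 3) / (r - 2) * a + (1 - (r - 3) / (r - 2)) * (3 - γ)) / 3 ≤
      max (3 - min ((r - 3) / (r - 2) * a + (1 - (r - 3) / (r - 2)) * (3 - γ))
        (((r - 3) / (r - 2) * a + (1 - (r - 3) / (r - 2)) * (3 - γ)) / 3 + a)) (1 / 3) ∧
    a + min ((r - 2 - γ) / (r - 2)) (2 / 3) ≤
      4 - max (3 - min ((r - 3) / (r - 2) * a + (1 - (r - 3) / (r - 2)) * (3 - γ))
        (((r - 3) / (r - 2) * a + (1 - (r - 3) / (r - 2)) * (3 - γ)) / 3 + a)) (1 / 3) := by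
  set θ : ℝ := (r - 3) / (r - 2) with hθ
  set b : ℝ := θ * a + (1 - θ) * (3 - γ) with hb
  set m : ℝ := min b (b / 3 + a) with hm
  set δ : ℝ := min ((r - 2 - γ) / (r - 2)) (2 / 3) with hδ
  have hr2 : 0 < r - 2 := by linarith
  have hθ0 : 0 ≤ θ := div_nonneg (by linarith) hr2.le
  have hθ1 : θ < 1 := (div_lt_one hr2).2 (by linarith)
  have h1θ : 1 - θ = 1 / (r - 2) := by rw [hθ]; field_simp; ring
  have h1θ0 : 0 < 1 - θ := by linarith
  have hδ₁ : 0 < (r - 2 - γ) / (r - 2) := div_pos (by linarith) hr2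
  -- `(1−θ)(3−γ) > (5−r)/(r−2) ≥ −1`, so `b > −1`
  have hbl : -1 < b := by
    have h1 : (1 - θ) * (3 - γ) = (3 - γ) / (r - 2) := by rw [h1θ]; ring
    have h2 : -1 < (3 - γ) / (r - 2) := by
      rw [lt_div_iff₀ hr2]; linarith
    have h3 : 0 ≤ θ * a := mul_nonneg hθ0 (by linarith)
    linarith
  -- `b > 2α − 1`
  have hbα : 2 * α - 1 < b := by
    have h1 : b - (2 * α - 1) = θ * (a - 2 * α) + ((1 - θ) * (3 - γ - 2 * α) + 1) := by rw [hb]; ring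
    have h2 : 0 ≤ θ * (a - 2 * α) := mul_nonneg hθ0 (by linarith)
    have h3 : 0 < (1 - θ) * (3 - γ - 2 * α) + 1 := by
      rw [h1θ]
      have : (1 / (r - 2)) * (3 - γ - 2 * α) + 1 = (r + 1 - γ - 2 * α) / (r - 2) := by
        field_simp; ring
      rw [this]
      exact div_pos (by linarith) hr2
    linarith
  -- `1 + b − a ≥ (r−2−γ)/(r−2)`
  have hba : (r - 2 - γ) / (r - 2) ≤ 1 + b - a := by
    have h1 : 1 + b - a = 1 - (1 - θ) * (a - (3 - γ)) := by rw [hb]; ring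
    have h2 : (1 - θ) * (a - (3 - γ)) ≤ (1 - θ) * (3 - (3 - γ)) :=
      mul_le_mul_of_nonneg_left (by linarith) h1θ0.le
    have h3 : 1 - (1 - θ) * (3 - (3 - γ)) = (r - 2 - γ) / (r - 2) := by
      rw [h1θ]; field_simp; ring
    linarith
  refine ⟨lt_min hδ₁ (by norm_num), ?_, ?_, ?_, ?_⟩
  · -- convergence of the dyadic sums
    have hm1 : 2 * α - 1 < m := lt_min hbα (by linarith)
    have : max (3 - m) (1 / 3) < 4 - 2 * α := max_lt (by linarith) (by linarith)
    linarith
  · exact le_max_of_le_left (by linarith [min_le_left b (b / 3 + a)])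
  · exact le_max_of_le_left (by linarith [min_le_right b (b / 3 + a)])
  · have hδ1 : δ ≤ (r - 2 - γ) / (r - 2) := min_le_left _ _
    have hδ2 : δ ≤ 2 / 3 := min_le_right _ _
    have hm2 : a + δ - 1 ≤ m := le_min (by linarith) (by linarith)
    have : max (3 - m) (1 / 3) ≤ 4 - a - δ := max_le (by linarith) (by linarith)
    linarith

/-- **Bronzi–Shvydkoy 2015, Theorem 1.1 — the exclusion half, at the profile level, from the
pressure law.** Let `(U, P)` be a stationary self-similar Euler profile pair with exponent
`γ = 1/(α+1)`, `0 < α < 3/2` (`U ∈ C²`, `P ∈ C¹`, CIV (3.3)), with: the energy growth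
`∫_{|y|<L}|U|² ≤ C_E L^{3−2α}` ((1.6)); the shell growth `∫_{L<|y|<2L}|U|^r ≤ C₂ L^γ'`, `r ≥ 3`,
`γ' < r − 2` ((1.7)); and the dyadic pressure law (2.4) at exponent `3/2`
(`SelfSimilarEulerPressureShellBound.lean`).  If the rescaled energies `L^{2α−3}∫_{|y|<L}|U|²` are
frequently small, then `U = 0`.  Proof: BS15 §3 verbatim — the reversed two-scale inequality (3.1)
(tree `twoScaleEnergy_le_dyadicFlux_of_frequently_small`), the interpolation
`⟨|v|³⟩ ≤ ⟨|v|²⟩^θ⟨|v|^p⟩^{1−θ}` and the recursion of Claim 3.1, which raises the energy rate by a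
fixed `δ > 0` per step until it exceeds `3`, i.e. `∫_{|y|<L}|v|² ≲ L^{−ε}`, "which implies `v ≡ 0`".
[cite: BronziShvydkoy2015, §3 (proof of Thm. 1.1) and Claim 3.1] -/
theorem _root_.Literature.Analysis.FluidPDE.IsSelfSimilarEulerProfile.eq_zero_of_shellGrowth_of_pressureLaw
    {α : ℝ} {U : EuclideanSpace ℝ (Fin 3) → EuclideanSpace ℝ (Fin 3)} {P : EuclideanSpace ℝ (Fin 3) → ℝ}
    (h : IsSelfSimilarEulerProfile (1 / (α + 1)) 0 U P) (hα : 0 < α) (hα2 : α < 3 / 2)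
    {C_E L_E : ℝ} (hCE : 0 ≤ C_E) (hLE : 0 < L_E)
    (hE : ∀ L : ℝ, L_E ≤ L →
      ∫ y in ball (0 : EuclideanSpace ℝ (Fin 3)) L, ‖U y‖ ^ 2 ≤ C_E * L ^ (3 - 2 * α))
    {r γ C₂ L₂ : ℝ} (hr : 3 ≤ r) (hγ : γ < r - 2) (hC₂ : 0 ≤ C₂)
    (hS : ∀ L : ℝ, L₂ ≤ L →
      ∫ y in {y : EuclideanSpace ℝ (Fin 3) | L < ‖y‖ ∧ ‖y‖ < 2 * L}, ‖U y‖ ^ r ≤ C₂ * L ^ γ)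
    {K L₃ : ℝ} (hK : 0 ≤ K)
    (hPl : ∀ L : ℝ, L₃ ≤ L →
      (∫ y in {y : EuclideanSpace ℝ (Fin 3) | L < ‖y‖ ∧ ‖y‖ < 2 * L}, |P y| ^ (3 / 2 : ℝ)) ^ (2 / 3 : ℝ) ≤
        K * ((∫ z in {z : EuclideanSpace ℝ (Fin 3) | L / 2 ≤ ‖z‖ ∧ ‖z‖ < 4 * L}, ‖U z‖ ^ (3 : ℝ)) ^ (2 / 3 : ℝ) +
          L ^ 2 * (L⁻¹ ^ 3 * (∫ z in ball (0 : EuclideanSpace ℝ (Fin 3)) (L / 2), ‖U z‖ ^ 2) +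
            ∫ z in {z : EuclideanSpace ℝ (Fin 3) | 4 * L ≤ ‖z‖}, ‖U z‖ ^ 2 / ‖z‖ ^ 3)))
    (hsmall : ∀ ε : ℝ, 0 < ε → ∀ M : ℝ, ∃ L : ℝ, M ≤ L ∧
      L ^ (2 * α - 3) * ∫ y in ball (0 : EuclideanSpace ℝ (Fin 3)) L, ‖U y‖ ^ 2 ≤ ε) :
    U = 0 := by
  have hUc : Continuous U := h.contDiff_velocity.continuous
  have hPc : Continuous P := h.contDiff_pressure.continuous
  set θ : ℝ := (r - 3) / (r - 2) with hθ
  set δ : ℝ := min ((r - 2 - γ) / (r - 2)) (2 / 3) with hδ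
  have hδ0 : 0 < δ := (claim31_step hα hα2 hr hγ le_rfl (by linarith)).1
  -- the rates `a_n = 2α + nδ`, as long as `a_{n-1} ≤ 3`
  have hiter : ∀ n : ℕ, 2 * α + n * δ ≤ 3 + δ → ∃ C L₀ : ℝ, 0 ≤ C ∧ 0 < L₀ ∧ ∀ L : ℝ, L₀ ≤ L →
      ∫ y in ball (0 : EuclideanSpace ℝ (Fin 3)) L, ‖U y‖ ^ 2 ≤ C * L ^ (3 - (2 * α + n * δ)) := by
    intro n
    induction n with
    | zero =>
      intro _
      refine ⟨C_E, L_E, hCE, hLE, fun L hL => ?_⟩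
      simpa using hE L hL
    | succ n ih =>
      intro hn
      have hn' : 2 * α + (n : ℝ) * δ ≤ 3 + δ := by push_cast at hn; linarith
      obtain ⟨C, L₀, hC0, hL₀, hrate⟩ := ih hn'
      set a : ℝ := 2 * α + n * δ with ha
      have hnδ : (0 : ℝ) ≤ n * δ := by positivity
      have ha2 : 2 * α ≤ a := by linarith [ha, hnδ]
      have ha3 : a ≤ 3 := by push_cast at hn; linarith [ha, hn]
      obtain ⟨-, hs, he₁, he₂, he₃⟩ := claim31_step hα hα2 hr hγ ha2 ha3
      set b : ℝ := θ * a + (1 - θ) * (3 - γ) with hb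
      set e : ℝ := max (3 - min b (b / 3 + a)) (1 / 3) with he
      -- current energy rate in the form `C L^{3−a}`
      have hEa : ∀ L : ℝ, L₀ ≤ L →
          ∫ y in ball (0 : EuclideanSpace ℝ (Fin 3)) L, ‖U y‖ ^ 2 ≤ C * L ^ (3 - a) := hrate
      -- the `L³` shell rate
      set p₃ : ℝ := (3 - a) * θ + γ * (1 - θ) with hp₃
      have hp₃b : p₃ = 3 - b := by rw [hp₃, hb]; ring
      set C₃ : ℝ := C ^ θ * (2 : ℝ) ^ ((3 - a) * θ) * C₂ ^ (1 - θ) with hC₃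
      have hC₃0 : 0 ≤ C₃ := by
        have hr2 : 0 < r - 2 := by linarith
        have hθ0 : 0 ≤ θ := div_nonneg (by linarith) hr2.le
        positivity
      have hX3 : ∀ M : ℝ, max L₀ L₂ ≤ M →
          ∫ y in {y : EuclideanSpace ℝ (Fin 3) | M < ‖y‖ ∧ ‖y‖ < 2 * M}, ‖U y‖ ^ (3 : ℝ) ≤ C₃ * M ^ p₃ :=
        fun M hM => shell_L3_rate hUc hr hC0 hC₂ hL₀ hEa hS hM
      -- the pressure rate
      have hapos : 0 < a := by linarith
      set M₁ : ℝ := max L₀ L₂ with hM₁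
      have hY : ∀ M : ℝ, 2 * max (max L₀ M₁) L₃ ≤ M →
          (∫ y in {y : EuclideanSpace ℝ (Fin 3) | M < ‖y‖ ∧ ‖y‖ < 2 * M}, |P y| ^ (3 / 2 : ℝ)) ^ (2 / 3 : ℝ) ≤
            K * (C₃ * ((1 / 2 : ℝ) ^ p₃ + 1 + (2 : ℝ) ^ p₃)) ^ (2 / 3 : ℝ) * M ^ (2 / 3 * p₃) +
              K * (C * (1 / 2 : ℝ) ^ (3 - a) + C * (2 : ℝ) ^ (3 - a) * (1 - (2 : ℝ) ^ (-a))⁻¹ * (4 : ℝ) ^ (-a)) *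
                M ^ (2 - a) :=
        fun M hM => shell_pressure_rate hUc hapos hC0 hC₃0 hK hL₀ hEa hX3 hPl hM
      -- the flux rate, on the common threshold
      set Mb : ℝ := 2 * max (max L₀ M₁) L₃ + M₁ + 1 with hMb
      have hMb1 : max L₀ L₂ ≤ Mb := by
        rw [hMb, hM₁]
        have : 0 ≤ 2 * max (max L₀ (max L₀ L₂)) L₃ :=
          mul_nonneg two_pos.le ((hL₀.le.trans (le_max_left _ _)).trans (le_max_left _ _))
        linarith
      have hMb2 : 2 * max (max L₀ M₁) L₃ ≤ Mb := by
        rw [hMb]; have : 0 ≤ M₁ := hL₀.le.trans (le_max_left _ _); linarith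
      have hMb0 : 0 < Mb := hL₀.trans_le ((le_max_left _ _).trans hMb1)
      have hKY1 : 0 ≤ K * (C₃ * ((1 / 2 : ℝ) ^ p₃ + 1 + (2 : ℝ) ^ p₃)) ^ (2 / 3 : ℝ) := by positivity
      have hW0 : 0 ≤ (1 - (2 : ℝ) ^ (-a))⁻¹ := by
        have : (2 : ℝ) ^ (-a) < 1 := Real.rpow_lt_one_of_one_lt_of_neg one_lt_two (by linarith)
        exact inv_nonneg.2 (by linarith)
      have hKY2 : 0 ≤ K * (C * (1 / 2 : ℝ) ^ (3 - a) + C * (2 : ℝ) ^ (3 - a) * (1 - (2 : ℝ) ^ (-a))⁻¹ * (4 : ℝ) ^ (-a)) := by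
        positivity
      have he₂' : 2 / 3 * p₃ + p₃ / 3 ≤ e := by rw [hp₃b]; linarith
      have he₃' : 2 - a + p₃ / 3 ≤ e := by rw [hp₃b]; linarith
      have he₁' : p₃ ≤ e := by rw [hp₃b]; exact he₁
      have hF := fun M (hM : max Mb 1 ≤ M) => shell_flux_rate hUc hPc hC₃0 hKY1 hKY2 he₁' he₂' he₃'
        (fun L hL => hX3 L (hMb1.trans hL)) (fun L hL => hY L (hMb2.trans hL)) hM
      -- the new energy rate
      have hMb' : 0 < max Mb 1 := lt_max_of_lt_right one_pos
      obtain ⟨C', hC'0, hnew⟩ := h.energyRate_step (by linarith) hα2.le hsmall (by positivity) hMb'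
        hs hF
      have hgain : e - 1 ≤ 3 - (2 * α + ((n + 1 : ℕ) : ℝ) * δ) := by
        push_cast
        have : a + δ ≤ 4 - e := by
          have := (claim31_step hα hα2 hr hγ ha2 ha3).2.2.2.2; rwa [← hb] at this
        rw [ha] at this; linarith
      refine ⟨C', max Mb 1, hC'0, hMb', fun L hL => (hnew L hL).trans ?_⟩
      exact mul_le_mul_of_nonneg_left
        (Real.rpow_le_rpow_of_exponent_le ((le_max_right _ _).trans hL) hgain) hC'0
  -- terminate: the first `n` with `2α + nδ > 3`
  set N : ℕ := ⌊(3 - 2 * α) / δ⌋₊ + 1 with hN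
  have hx0 : 0 ≤ (3 - 2 * α) / δ := div_nonneg (by linarith) hδ0.le
  have hN1 : 3 < 2 * α + N * δ := by
    have h1 : (3 - 2 * α) / δ < (⌊(3 - 2 * α) / δ⌋₊ : ℝ) + 1 := Nat.lt_floor_add_one _
    have h2 : 3 - 2 * α < ((⌊(3 - 2 * α) / δ⌋₊ : ℝ) + 1) * δ := by
      rwa [div_lt_iff₀ hδ0] at h1
    rw [hN]; push_cast; linarith
  have hN2 : 2 * α + N * δ ≤ 3 + δ := by
    have h1 : (⌊(3 - 2 * α) / δ⌋₊ : ℝ) ≤ (3 - 2 * α) / δ := Nat.floor_le hx0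
    have h2 : (⌊(3 - 2 * α) / δ⌋₊ : ℝ) * δ ≤ 3 - 2 * α := by rwa [le_div_iff₀ hδ0] at h1
    rw [hN]; push_cast; linarith
  obtain ⟨C, L₀, -, -, hrate⟩ := hiter N hN2
  refine eq_zero_of_energyGrowth_of_three_halves_lt (α := (2 * α + N * δ) / 2) (C := C) (L₀ := L₀)
    (by linarith) hUc fun L hL => ?_
  have e : 3 - 2 * ((2 * α + N * δ) / 2) = 3 - (2 * α + N * δ) := by ring
  rw [e]
  exact hrate L hL

/-- **Bronzi–Shvydkoy 2015, Theorem 1.1 at the profile level (the dichotomy).** Under the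
hypotheses of `eq_zero_of_shellGrowth_of_pressureLaw` except the smallness: either `U = 0`, or the
energy is TWO-SIDED, `c L^{3−2α} ≤ ∫_{|y|<L}|U|² ≤ C L^{3−2α}` for all large `L`, with `c > 0`
(the printed (1.8)). [cite: BronziShvydkoy2015, §1 Thm. 1.1 eq. (1.8)] -/
theorem _root_.Literature.Analysis.FluidPDE.IsSelfSimilarEulerProfile.energy_dichotomy_of_shellGrowth_of_pressureLaw
    {α : ℝ} {U : EuclideanSpace ℝ (Fin 3) → EuclideanSpace ℝ (Fin 3)} {P : EuclideanSpace ℝ (Fin 3) → ℝ}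
    (h : IsSelfSimilarEulerProfile (1 / (α + 1)) 0 U P) (hα : 0 < α) (hα2 : α < 3 / 2)
    {C_E L_E : ℝ} (hCE : 0 ≤ C_E) (hLE : 0 < L_E)
    (hE : ∀ L : ℝ, L_E ≤ L →
      ∫ y in ball (0 : EuclideanSpace ℝ (Fin 3)) L, ‖U y‖ ^ 2 ≤ C_E * L ^ (3 - 2 * α))
    {r γ C₂ L₂ : ℝ} (hr : 3 ≤ r) (hγ : γ < r - 2) (hC₂ : 0 ≤ C₂)
    (hS : ∀ L : ℝ, L₂ ≤ L →
      ∫ y in {y : EuclideanSpace ℝ (Fin 3) | L < ‖y‖ ∧ ‖y‖ < 2 * L}, ‖U y‖ ^ r ≤ C₂ * L ^ γ)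
    {K L₃ : ℝ} (hK : 0 ≤ K)
    (hPl : ∀ L : ℝ, L₃ ≤ L →
      (∫ y in {y : EuclideanSpace ℝ (Fin 3) | L < ‖y‖ ∧ ‖y‖ < 2 * L}, |P y| ^ (3 / 2 : ℝ)) ^ (2 / 3 : ℝ) ≤
        K * ((∫ z in {z : EuclideanSpace ℝ (Fin 3) | L / 2 ≤ ‖z‖ ∧ ‖z‖ < 4 * L}, ‖U z‖ ^ (3 : ℝ)) ^ (2 / 3 : ℝ) +
          L ^ 2 * (L⁻¹ ^ 3 * (∫ z in ball (0 : EuclideanSpace ℝ (Fin 3)) (L / 2), ‖U z‖ ^ 2) +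
            ∫ z in {z : EuclideanSpace ℝ (Fin 3) | 4 * L ≤ ‖z‖}, ‖U z‖ ^ 2 / ‖z‖ ^ 3))) :
    U = 0 ∨
      ∃ c C L₀ : ℝ, 0 < c ∧ ∀ L : ℝ, L₀ ≤ L →
        c * L ^ (3 - 2 * α) ≤ ∫ y in ball (0 : EuclideanSpace ℝ (Fin 3)) L, ‖U y‖ ^ 2 ∧
          ∫ y in ball (0 : EuclideanSpace ℝ (Fin 3)) L, ‖U y‖ ^ 2 ≤ C * L ^ (3 - 2 * α) := by
  by_cases hsmall : ∀ ε : ℝ, 0 < ε → ∀ M : ℝ, ∃ L : ℝ, M ≤ L ∧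
      L ^ (2 * α - 3) * ∫ y in ball (0 : EuclideanSpace ℝ (Fin 3)) L, ‖U y‖ ^ 2 ≤ ε
  · exact Or.inl (h.eq_zero_of_shellGrowth_of_pressureLaw hα hα2 hCE hLE hE hr hγ hC₂ hS hK hPl hsmall)
  · right
    push Not at hsmall
    obtain ⟨ε, hε, M, hM⟩ := hsmall
    refine ⟨ε, C_E, max M L_E, hε, fun L hL => ⟨?_, hE L ((le_max_right _ _).trans hL)⟩⟩
    have hL0 : 0 < L := hLE.trans_le ((le_max_right _ _).trans hL)
    have h1 := hM L ((le_max_left _ _).trans hL)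
    have hpos : 0 < L ^ (3 - 2 * α) := Real.rpow_pos_of_pos hL0 _
    have h2 := mul_lt_mul_of_pos_left h1 hpos
    have e : L ^ (3 - 2 * α) * (L ^ (2 * α - 3) * ∫ y in ball (0 : EuclideanSpace ℝ (Fin 3)) L, ‖U y‖ ^ 2) =
        ∫ y in ball (0 : EuclideanSpace ℝ (Fin 3)) L, ‖U y‖ ^ 2 := by
      rw [← mul_assoc, ← Real.rpow_add hL0]; norm_num
    rw [e, mul_comm] at h2
    exact h2.le

end BronziShvydkoy2015

end Literature.Analysis.FluidPDE
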